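import Mathlib
import HarnessLib
import HarnessLib.Audit
import Summits.QuantumAdvantage.Statement
import Summits.QuantumAdvantage.QuantumAdvantage.Theorems.FlatDialStrings
import Literature.Computability.QuantumComplexity.SignedExactCubicSliceANF
import Literature.Computability.QuantumComplexity.CubicForrelation
import Literature.Computability.QuantumComplexity.Forrelation
import Literature.Computability.Cryptography.ClassBQP
import Literature.Computability.Complexity.Promise
import Literature.Computability.Complexity.PromiseZPPProofs
import Literature.Computability.Complexity.ConstantDepth
import Literature.Computability.Complexity.UniformCircuitClasses
import Literature.Computability.Complexity.Classes
import HarnessLib.Audit.Status.Attr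

/-!
Route: FlatDial

# Route FlatDial — Flat dial on the ANF sign problem's AC0[parity] rung - normality-flat SEARCH for
one cubic bent function is hard (W, necessary mod N) plus a declared search-to-decision residual
(refines 27991)

DECOMPOSITION CELL decomp-qadv (D-0178/D-0179), RESIDUAL MODE, node «FlatDial» (lens
decomp-qadv-lens-3 g11; node file FlatDial.lean rev 3 sha256
cbbf0309dbd50ef571eb7fe613aa33d2867e11013d14825154bd3badacaf9c7f (rev 1 fbf81591…, rev 2 c6632723…),
record NODE-g11.md, probes
bc7_probe_FlatDial.out fca68210…; critic decomp-qadv-crit-1 rows 71 VERIFIED (kernel HIGH / split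
MEDIUM-minus), 71v2 CLEARED («T ⟸ W ∧ L;
sibling route on 27991 = crux W + residual L + inherited 14043/27985/27984/27986 by name; NO items
for T_tab / T′ / SliceNormal /
FlatRecoveryExists / W_M»), 71v3 (verdict unchanged), 71v4–71v11 (tree modules VERIFIED); tree
package Theorems/FlatDialReadout d7e73666 →
FlatDialCircuit 0f619123 → FlatDialSearch fceb650b → FlatDialStrings 72c1dd68 → FlatDialRigid
c37cd800 + FlatDialLemmaU 05b31c5d / FlatDialMMDual
3483d105 / FlatDialCubeKey 335ab217 / FlatDialMCert e06e6d3c / FlatDialLCert 32ca84e4 LANDED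
--supports stmt-QuantumAdvantage-27991 by census-1 g7;
instrument data K-FLAT8 (decomp-qadv-lens-3/g11/instrument/K-FLAT8.md sha256 692238a7…, flats8.out
064c618a…) and K-MSUB (msub.out cd8e436e…)).
ROOT CURRENCY: `closes` concludes `QuantumAdvantage` itself, through AnfPresentation's inherited
chain (as the sibling TrustDial does on 27983).
SECOND SIBLING on the AnfPresentation BLOCKER, this time on the NON-UNIFORM rung T = item 27991
`AnfPresentation.RungANonuniform` («the signed
exact cubic slice in ANF presentation ∉ promiseLift(AC⁰[⊕])», target r0, shared verbatim; T ⟹ 27983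
RungA by promise-class monotonicity, kernel
`rungA_of_target`). THE ONE EQUIV (PROVED both ways in the tree,
`signedSlice_not_mem_promiseLift_iff_no_flatReadout` modulo the side condition N
«every signed cubic dual of even arity is weakly normal» — N is NOT an item): the sign of an exact
cubic pair (F,G) is ONE PARITY read off ANY
normality flat of G (a dimension-n/2 affine flat on which G is constant: `flat_readout`, kernel), so
modulo N the decision problem T ⟺ «no
table-level AC⁰[⊕] family computes the canonical flat readout» (T′). BENEATH the EQUIV the node
splits by the SOLVER'S OUTPUT TYPE (decision ↦
search): it suffices to show X = FlatSearchHard ∧ SearchLift (kernel `target_of_pieces`,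
`target_iff_pieces hN`, Sketch.lean rc 0): W = FLAT SEARCH
IS AC⁰[⊕]-HARD — no constant-depth polynomial-size AND/OR/NOT/⊕ family of certificate maps, reading
the ANF table of G ALONE, outputs a valid flat
certificate (an n/2-dimensional affine flat on which G is constant) for every weakly-normal signed
cubic dual G of even arity (a SEARCH lower bound
about ONE bent function: no partner table, no sign, no promise gap; NECESSARY for T modulo N alone,
`no_finder_of_signedSlice_not_mem`); L = the
DECLARED RESIDUAL SearchLift := FlatSearchHard → RungANonuniform (search-to-decision for normality
flats INSIDE AC⁰[⊕]; ≡ T modulo W). The other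
binders of `closes` are AnfPresentation's own chain, VERBATIM shared items 14043 NearExactIsExact →
27985 SignedExactSliceIsLift, 27984 LiftA (the
parent's A03 residual, untouched — the line carries TWO residuals, SearchLift beneath T and LiftA
above it, and says so), 27986 AnfEquiv, records
27983 RungA / 27982 AnfResidual. Every item is stated over tree constants; the junctions T ↔ tree, W
↔ the hypothesis type of
`Theorems.FlatDial.no_finder_of_recovery`, node-form L (W → T′) ⟹ filed L (`searchLift_of_node`,
unconditional) and filed L ⟹ node-form L mod N
(`node_of_searchLift`) are kernel-checked in the writer's Sketch.lean (farm rc 0 · 0 sorry · closes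
axioms propext/Classical.choice/Quot.sound).
Lean: `(¬ ∃ c : (n : ℕ) → (Fin (Summit.QuantumAdvantage.QuantumAdvantage.Theorems.FlatDial.formN n)
→ Bool) → Summit.QuantumAdvantage.QuantumAdvantage.Theorems.FlatDial.CertIdx n → Bool, c ∈
Summit.QuantumAdvantage.QuantumAdvantage.Theorems.FlatDial.realisableOutG
Summit.QuantumAdvantage.QuantumAdvantage.Theorems.FlatDial.CertIdx ∧ c ∈
Summit.QuantumAdvantage.QuantumAdvantage.Theorems.FlatDial.finders) ∧ (FlatSearchHard →
RungANonuniform)`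

## Assembly
Inside `closes` (glue.lean = Sketch.lean `closes`, 0 sorry, axioms propext / Classical.choice /
Quot.sound): `have p₁ : RungA := fun hA => (ℓ w)
(promiseLift_mono Set.inter_subset_left hA)` (T from W and L by modus ponens, then AC0Mod 2 ∩ P ⊆
AC0Mod 2); `h₃ := hE.mpr (p₂ p₁)` puts the
circuit-presentation slice outside PromiseBPP′; assuming ¬QuantumAdvantage, i.e. BQP ⊆ BPP,
`promiseLift_mono` + `PromiseBPP_subset_PromiseBPP'_holds`
carry `h₂ h₁ : slice ∈ promiseLift BQP` into PromiseBPP′ — contradiction. Binders consumed 6/6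
(NearExactIsExact, SignedExactSliceIsLift,
FlatSearchHard, SearchLift, LiftA, AnfEquiv); RungANonuniform / RungA / AnfResidual are in the cone
as the types named inside SearchLift / LiftA /
AnfEquiv; bc6 expected declared 10 / in-cone 9 / aside 0 / exempt Assembly.

Rationale: WHY THIS LINE. Mechanism (lens-3 g11, every layer kernel-checked and LANDED as Theorems/FlatDial*
--supports 27991): for an EXACT cubic pair Φ(F,G) = ±1 the partner
is G = F̃ ⊕ b with F bent, and if G is weakly normal — constant on an affine flat a + E with dim E =
n/2 — then the dual relation [corpus:carlet2020
p.252] Rel. (6.7) / flat duality [corpus:carlet2020 p.318] makes the sign b ONE PARITY of F's ANF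
coefficients over E (tree `flat_readout`,
`pairOf_tabOf`, `rungATab_of_flatRung`/`flatRung_of_rungATab`): a flat is a SIGN CERTIFICATE
checkable in AC⁰[⊕] (rank by affine independence of
the listed basis, constancy by ⊕ over the coset). Hence, modulo N, deciding the sign inside AC⁰[⊕]
is exactly as hard as PRODUCING some flat inside
AC⁰[⊕], and the blocker factors into a pure search lower bound W plus the search-to-decision
residual L. Imported from Boolean-function theory /
coding (normality and duals of bent functions: Dillon 1974, Carlet 2020, Polujan–Pasalic–Kudin–Zhang
arXiv:2304.13432 Lemma 1.2 = Dillon's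
M-subspace criterion, Thm 3.1 uniqueness) into the AC⁰[⊕] rung of the Raz–Tal / Bansal–Sinha
cubic-Forrelation sign problem (arXiv:1411.5729,
arXiv:2102.06963) with Razborov–Smolensky projection planting (doi:10.1145/28395.28404, tree
`Smolensky1987_modq_not_mem_AC0Mod_holds`) as the
attack engine: W ⟸ the existence of a FLAT-RECOVERY family (tree schema `no_finder_of_recovery`),
and its rigid analogue W_M (M-subspace = Dillon
certificate search) is a THEOREM-CANDIDATE whose ingredients are already kernel-proved in the tree —
Lemma U `LemmaU.msubspace_unique` (the
M-subspace of a cube-key Maiorana–McFarland direct sum is unique), MM duality for an arbitrary key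
`isDualOf_mmFun`, the cube key
`msubspace_unique_cubeMM` / `forrelation_cubeMM = 1`, the span of valid M-certificates of a FRAMED
cube-key function `mem_span_iff_frame`, and
`lCert_mem_validMCerts` (modules 6–10 LANDED; module 11 FlatDialFrame = the concrete unipotent MOD₃
frame A_w with `extractB_eq`, critic-VERIFIED
71v11) and — lens modules 12 FlatDialTrilin fd52de2b / 13 FlatDialTables f82aa47b (farm
Combined13.check.json rc0 · 0 sorry, axioms standard;
landing 11→12→13 pending, bus 2026-08-30T20:05:48Z) — the table-level AC⁰[⊕] realisation `plantAC` /
`acRealOver_cube`, so that `def mRecovery :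
MRecovery`, `nonempty_mRecovery` and W_M = `no_mfinder` are KERNEL-PROVED (cited BY NAME as support
once landed, never items). What the line
does that prior routes do not: AnfPresentation types the blocker as two DECISION rungs (27983
uniform, 27991 non-uniform) and TrustDial dials the
PROMISE (which strata of the partner's coefficients are trusted); this node dials the OUTPUT TYPE —
a search problem about one bent function with
short verifiable witnesses, whose quadratic shadow (Lagrangian-subspace extraction ⊇ 𝔽₂-basis
extraction, rank/unitriangular-inversion shadows
AC⁰[⊕]-hard) explains why L cannot be degree-blind while the quadratic DECISION problem is
AC⁰[⊕]∩P-easy (g3 ArfPin); nearest in-tree prior is the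
parent line's machine-level M-subspace sign readout
`Literature/Computability/QuantumComplexity/MSubspaceSignReadoutMachine.lean` (ns MMReadout) +
`ForrelationMSubspaceDuality.lean` + `ForrelationCosetAffineBound.lean` + the r3 line
`Cruxes/SignedExactCubicForrelationNotPrBPP/Lines/dual_pingpong_frame.lean`
(sign READOUT from an M-subspace given an abstract poly-time FINDER): the node's readout is the
exact-slice, AC⁰[⊕]-level, ONE-FLAT (weak
normality, one coset) specialisation — not new as a mechanism — while W / W_M as typed
SEARCH-hardness statements, their necessity for 27991, the
converse T ⟺ T_tab (module 4) and the lower bound «AC⁰[⊕] M-subspace finders do not exist» (W_M,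
kernel-proved in modules 12–13) are new relative
to the tree and bracket the parent's open poly-time finder stub from below. It respects the
negatives index (6 refuted statements, none in this vocabulary; no θ, no
partition-function claim).

RANKED CRUXES. #0 RungANonuniform (target) — T = SHARED tree item 27991
(AnfPresentation.RungANonuniform, verbatim; junction `Iff.rfl`): the signed exact cubic slice in ANF
presentation (language pair: encodings of even-arity cubic ANF pairs with Φ = +1 / Φ = −1) is not in
promiseLift(AC0Mod 2) — no language with constant-depth polynomial-size AND/OR/NOT/PARITY circuits
separates the two promise classes. Rank-0 record of what the two new pieces jointly decide (kernel
`target_of_pieces : FlatSearchHard → SearchLift → RungANonuniform`; `target_iff_pieces (hN :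
SliceNormal) : RungANonuniform ↔ FlatSearchHard ∧ SearchLift`); it feeds the root through T ⟹ RungA
(27983, `promiseLift_mono Set.inter_subset_left`) → LiftA (27984) → AnfEquiv (27986) → ¬(BQP ⊆ BPP)
with 14043/27985 (`closes`, 0 sorry). FLAT DIAL RECORD (lens-3 g11 FlatDial.lean cbbf0309, critic
71/71v2/71v3): T ⟺ T_tab (`signedSlice_not_mem_promiseLift_iff_no_signer`, tree module 4) ⟺ T′
FlatRung mod N (`signedSlice_not_mem_promiseLift_iff_no_flatReadout`); T′ → W_PG → W kernel; W
NECESSARY mod N (`no_finder_of_signedSlice_not_mem`); L ≡ T mod W. TAGS: UNDECIDED (A02-class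
constant-depth-with-parity lower bound for an explicit promise problem; Razborov–Smolensky applies
in principle) · not COSTUME (it is the parent's typed rung, two classes below the root's BPP). (why
it might fail: an AC⁰[⊕] sign algorithm for exact cubic pairs — e.g. a constant-depth parity circuit
extracting a normality flat (or the M-subspace) of G from its ANF and reading the sign off it; the
quadratic analogue IS easy (ArfPin, g3).) [arXiv:1411.5729, arXiv:2102.06963,
doi:10.1145/28395.28404, doi:10.1017/cbo9780511976667]
#2 FlatSearchHard (crux) — W — FLAT SEARCH IS AC⁰[⊕]-HARD (node def `FlatSearchHard`, tree
vocabulary `Theorems.FlatDial.realisableOutG` / `finders`, junction `Iff.rfl` = the hypothesis type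
of the LANDED `no_finder_of_recovery` / `signedSlice_not_mem_promiseLift_of_split`): there is NO
family c of certificate maps, one per arity n, computed output-bit-wise by AND/OR/NOT/⊕ circuits of
constant depth and polynomial size reading the ANF table of the cubic form G ALONE, such that for
every even n and every G that is a signed cubic dual (G ⊕ b = F̃ for some cubic bent F) AND weakly
normal, c(G) is a VALID FLAT CERTIFICATE (a point a and n/2 affinely independent directions spanning
E with G constant on a + E). TAGS (critic rows 71 VERIFIED / 71v2 CLEARED): NECESSARY for T modulo N
alone (`no_finder_of_signedSlice_not_mem hN hT`, tree module 4; for T′ unconditionally) · WEAKER by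
evidence (search ⊋ decision: a checkable (n²/2+2n)-bit witness vs one bit, converse = L unknown
inside AC⁰[⊕]; QUADRATIC CALIBRATION: the quadratic decision problem T′₂ is AC⁰[⊕]∩P-EASY (ArfPin)
while quadratic flat search W₂ ⊇ Lagrangian-subspace / 𝔽₂-basis extraction has no AC⁰[⊕] algorithm
and AC⁰[⊕]-hard decision shadows (rank, unitriangular inversion); ONE bent function, no partner /
sign / gap) · UNDECIDED (instrument K-FLAT8, n = 8: 12144 flats of the cube-key MM function vs 16
canonical, 480 near-canonical, ≥ 92 % skew — the flat menu is NOT rigid, so a recovery family must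
be basis-free; settles nothing) · ATTACKABLE NOW via the kernel attack schema
`no_finder_of_recovery` (W ⟸ Nonempty FlatRecovery) and its RIGID analogue W_M = M-certificate
search hardness (`no_mfinder_of_mRecovery`, module 5; W → W_M mod N_M is the identity on
certificates; W_M ⟸ Nonempty MRecovery whose ingredients Lemma U / MM duality / cube key / M-cert
span / L-cert are LANDED modules 6–10 and whose frame is module 11 — THEOREM-CANDIDATE, critic
71v3/71v11) · INSTRUMENTABLE (K-FLAT8 / K-MSUB small-n certificate censuses). W_M, W_PG (pair-table
search), T′, T_tab, N are NOT items (critic 71/71v2/71v3). [difficulty: L] (why it might fail: a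
parallel second-derivative flat finder: for cubic G the second derivatives D_aD_bG are affine, so a
constant-depth ⊕-circuit might assemble a normality flat (e.g. of near-canonical/mixed product type,
K-FLAT8) from the table of all D_aD_bG without ever inverting a frame.) [arXiv:2304.13432,
doi:10.1145/28395.28404, doi:10.1017/9781108606806, arXiv:1411.5729]
#3 SearchLift (crux) — L — DECLARED RESIDUAL of the split (NEW; filed in the decl-name form
«FlatSearchHard → RungANonuniform», the RigidityDial.RigidLiftOdd / TrustDial.PolarLift pattern; ≡ T
modulo W, `searchLift_of_target` trivially; the node's own form NodeSearchLift := W → T′ IMPLIES the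
filed form unconditionally by the LANDED `signedSlice_not_mem_promiseLift_of_split`
(`searchLift_of_node`), and the filed form gives the node form back modulo N (`node_of_searchLift`)
— so the side condition N is folded into L and is never a `closes` hypothesis, critic 71v2):
SEARCH-TO-DECISION INSIDE AC⁰[⊕] FOR NORMALITY FLATS — if no AC⁰[⊕] family finds a flat of a
weakly-normal signed cubic dual from its table, then no AC⁰[⊕] family decides the sign of exact
cubic ANF pairs. It carries the part of 27991 NOT explained by certificate search: a decision
circuit need not output a flat, and flats are far from unique (K-FLAT8), so the classical
witness-extraction-by-self-reduction is unavailable at constant depth. TAGS: DECLARED RESIDUAL ·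
UNDECIDED · IDEA-NEEDED (no technique converts an AC⁰[⊕] DECISION circuit for the sign into an
AC⁰[⊕] flat FINDER; must use degree 3 by the quadratic calibration) · no catalogued barrier applies.
Test that decides it: only with T (a proof of 27991 not passing through flat search moots it; ¬W
does NOT refute T but kills this line, see Kill criteria). [deps: FlatSearchHard] [difficulty:
open-problem] (why it might fail: exactly if flat SEARCH is AC⁰[⊕]-hard for generic reasons (witness
non-uniqueness, basis extraction) while the one-bit SIGN has a degree-3-specific constant-depth
⊕-formula avoiding certificates — the quadratic face behaves precisely so (search hard-looking,
decision easy).) [arXiv:1411.5729, arXiv:2102.06963, doi:10.1145/28395.28404, arXiv:2304.13432]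
#4 LiftA (crux) — AnfPresentation's declared residual stmt-QuantumAdvantage-27984 (body VERBATIM,
shared item; also TrustDial #4): from «the ANF slice ∉ promiseLift(AC⁰[⊕] ∩ P)» (27983 RungA,
obtained inside `closes` from T by monotonicity) to «the ANF slice ∉ PromiseBPP′» — the
BPP-vs-AC⁰[⊕] gap of the sign problem, A03-class (SeparationPrerequisites), declared as such there
and here; load-bearing binder p₂ of `closes`, staffed on AnfPresentation. This line does not touch
it: it carries TWO residuals, SearchLift beneath T and LiftA above it. [deps: RungANonuniform]
[difficulty: open-problem] (why it might fail: it is X-hard given RungA: a prBPP (even P) sign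
algorithm using un-mixing by Gaussian elimination (outside AC⁰[⊕]) — e.g. a poly-time M-subspace
finder, the parent line's open stub — would make RungA true and LiftA false.) [arXiv:1411.5729,
doi:10.1017/cbo9780511976667, arXiv:2102.06963]
#5 NearExactIsExact (crux) — shared item stmt-QuantumAdvantage-14043 (body VERBATIM;
CubicForrelation / AnfPresentation / TrustDial crux): isolation of exactness — an absolute θ < 1
such that for even n and 𝔽₂-degree-≤3 f, g, Φ(f,g) > θ ⇒ Φ(f,g) = 1. Binder h₁ of `closes` (feeds K2
= SignedExactSliceIsLift); staffed on its home routes. [difficulty: open-problem] (why it might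
fail: a sequence of cubic pairs with Φ → 1 from below without ever being exact (bent g with
NON-cubic dual close to RM(3): Φ = 1 − 2·dist(g̃, RM(3,n))/2ⁿ; known caps 3/4, 7/8 leave room
above).) [arXiv:1411.5729, doi:10.1017/cbo9780511976667]
#9 RungA (support) — shared item stmt-QuantumAdvantage-27983 (body VERBATIM; AnfPresentation crux r2
/ TrustDial target): the signed exact cubic slice in ANF presentation ∉ promiseLift(AC⁰[⊕] ∩ P). Not
a binder: DERIVED inside `closes` from T by `promiseLift_mono Set.inter_subset_left` (kernel
`rungA_of_target`); needed BY NAME by LiftA. Staffed on AnfPresentation / TrustDial. [difficulty: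
open-problem] [arXiv:1411.5729, doi:10.1145/28395.28404]
#9 SignedExactSliceIsLift (support) — shared item stmt-QuantumAdvantage-27985 (body VERBATIM; K2 of
CubicForrelation, PROVED in the tree
`Theorems.SignedExactSliceIsLift.signedExactSliceIsLift_holds`): NearExactIsExact ⟹ the signed exact
cubic slice (circuit presentation) ∈ promiseLift BQP. Binder h₂ of `closes`. [difficulty:
provable-now] [arXiv:1411.5729]
#9 AnfEquiv (support) — shared item stmt-QuantumAdvantage-27986 (body VERBATIM; E_pres of
AnfPresentation, PROVED both ways in the g2 node by Karp reductions with CodeFP certificates):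
CubicForrelation's r3 (circuit grain) ↔ AnfResidual. Binder hE of `closes`. [difficulty: M]
[arXiv:1411.5729, doi:10.1017/cbo9780511976667]
#9 AnfResidual (support) — shared record stmt-QuantumAdvantage-27982 (body VERBATIM;
AnfPresentation's target X_ANF, needed BY NAME by AnfEquiv): the signed exact cubic slice in ANF
presentation is not in PromiseBPP′. Not a binder; staffed on AnfPresentation. [difficulty:
open-problem] [arXiv:1411.5729, arXiv:2102.06963]

TWO-LAYER PLAN. FlatSearchHard ⇐ stub_mRecovery (Nonempty Theorems.FlatDial.MRecovery: the framed
cube-key Maiorana–McFarland M-recovery family EXISTS — BC5 RUNG,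
the node's W_M in constructive form; PROVED as `Theorems.FlatDial.nonempty_mRecovery` in lens
modules 12–13 (farm rc0, landing pending), filed
PLAN-ONLY until module 13 is in the tree) ∧ stub_liftMSub (hardness of
M-CERTIFICATE search ⇒ hardness of FLAT search — the open «junk-freeness» step: every normality flat
of the framed planting, incl. near-canonical /
mixed product flats of K-FLAT8, must leak the frame) — BC3 skeleton bc-fd/FlatSearchHard_birth.lean
(`FlatSearchHard_of` PROVED from the two stubs
through the LANDED `no_mfinder_of_mRecovery`). SearchLift ⇐ stub_partnerUseless (W ⇒ pair-table
search hardness W_PG; tree has the converse) ∧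
stub_searchToDecision (W_PG ⇒ flat-READOUT hardness T′) — bc-fd/SearchLift_birth.lean
(`SearchLift_of` PROVED via
`signedSlice_not_mem_promiseLift_of_split`). Nothing here is filed now.

KILL CRITERIA. A constant-depth polynomial-size AND/OR/NOT/⊕ family that outputs a valid normality
flat for every weakly-normal signed cubic dual refutes
FlatSearchHard — close --reason refuted:FlatSearchHard (the LINE dies; T 27991 is NOT thereby
refuted, but by `no_finder_of_signedSlice_not_mem`
¬W ∧ N ⟹ ¬T, so such a finder together with a proof of N sinks 27991, 27983 RungA (TrustDial's
target) by monotonicity and — modulo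
promiseLift(AC0Mod 2 ∩ P) ⊆ PromiseBPP′ — the whole ANF lineage; only a finder confined to
MM#/framed instances is survivable, re-targeting W to
the complement class). An AC⁰[⊕] SIGN algorithm refutes T, L and the parent rungs alike. A
refutation of NearExactIsExact (14043) breaks `closes`
here and on AnfPresentation / TrustDial / CubicForrelation. A non-weakly-normal signed cubic dual
(¬N, first open arity n = 10) does NOT kill the
route (N is no binder) but removes W's necessity tag. Proved elsewhere: 27991 proved directly (e.g.
a Smolensky-type decision lower bound) moots
SearchLift and proves W mod N.

NOT DECOMPOSED YET. SearchLift stays whole (declared residual; its plan is the two-stub skeleton,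
not items). W_M (MSubSearchHard), W_PG (PairFlatSearchHard), T′
(FlatRung), T_tab (RungATab), the side conditions N (SliceNormal) / N_M (SliceMM) and A_W
(FlatRecoveryExists) are NOT items (critic 71/71v2/71v3):
W_M is W's first line (`Lines/birth.lean` stub_mRecovery) and is kernel-proved (`no_mfinder`,
modules 12–13, landing pending); N calibrates necessity only. The
uniform twin (27983 ∩ P) is reached only through T → RungA. No item for the K-FLAT8 / K-MSUB finite
proxies.

CHEAPEST FALSIFIER. Decide at n = 8 (paper, then a certificate census like K-FLAT8) whether EVERY
normality flat of the framed cube-key planting G_w = cubeMM ∘ A_w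
leaks MOD₃(w) through an AC⁰[⊕] map — if some flat family is frame-blind (near-canonical or mixed
product flats surviving the frame), stub_liftMSub
is dead and W needs a different planting; if additionally a uniform second-derivative recipe
produces such a flat for all cubic bent G, W is
refuted. Run so far: K-FLAT8 (12 s, n = 8 cube-key MM: 12144 flats, menu not rigid) and K-MSUB (r ≤
2: M-subspace unique, Lemma U exhaustive) —
consistent with W_M (now proved), silent on W.

NUMBERS. n even; flats have dimension n/2 (certificate = a + n/2 directions, (n/2+1)·n bits; ANF
table of G has formN n = 1 + n³ entries (tree `formN`);
AC⁰[⊕] = constant depth d, size r(n) polynomial (`realisableOutG`: ∃ d, ∃ r : Polynomial ℕ). K-FLAT8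
at n = 8: 12144 normality flats of the
cube-key MM function, 16 canonical, 480 near-canonical, ≥ 92 % skew. Cubic bent functions are
classified only for n ≤ 8, all normal there
[corpus:carlet2020 p.318]; first open arity for N is n = 10. Smolensky: MOD₃ ∉ AC⁰[⊕] (tree
`Smolensky1987_modq_not_mem_AC0Mod_holds 2 3`).

DEFINITION REQUESTS. None: every notion is in the landed tree modules (Theorems.FlatDial.formN /
CertIdx / realisableOutG / finders / validCerts / hasFlatCert /
FlatRecovery / MRecovery) or in Literature (promiseLift, AC0Mod, SignedExactCubicSliceANF).

Novelty: Searches (2026-08-30): lit search --hybrid "normal bent function flat affine subspace constant-depth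
circuit search lower bound" (8 docs: mesnager2016 pp 95–96/366, carlet2020 pp 252/254/318/596,
jukna2012 pp 356–361, arora2009 p 366 — bent-function normality and AC⁰[⊕] lower bounds separately,
never together); lit vsearch "complexity of finding an affine subspace of dimension n/2 on which a
bent function is constant … constant-depth circuits with parity gates" (8 docs, same books +
chen2024 p 215, krajicek p 493: no statement about FINDING flats); lit galaxy search "normal bent
function" --star pdf (2 hits: [galaxy:pdf:101549115798387460] Polujan–Mariot–Picek BFA 2023
«Normality of Boolean bent functions in eight variables, revisited»,
[galaxy:pdf:8435340571879309860] Primorska thesis on bent functions outside M#), "normal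
bent|normality of bent|weakly normal" --star all (16 rows, all noise), "M-subspace" --star pdf (0
relevant); lens-3 presearch [corpus:carlet2020 p.252/p.258/p.318], [corpus:paper:arxiv-2304.13432
p.5, p.9–11]; ledger negatives --problem QuantumAdvantage (6, none in this vocabulary); in-tree:
lean search for the FlatDial vocabulary finds only the ten landed modules; BC4 `exact?` on W / L
FAILS.
Nearest prior art found: in-tree
`Literature/Computability/QuantumComplexity/MSubspaceSignReadoutMachine.lean` (MMReadout: sign
readout from an M-subspace given an abstract poly-time finder, dual-pair sampler) with
`ForrelationMSubspaceDuality.lean`, `ForrelationCose  [refs: 2304.13432, paper:arxiv-2304.13432]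

Barriers (technique_class: decomposition, razborov-smolensky, projection-planting): - technique_class: decomposition, razborov-smolensky, projection-planting
- Literature.Barriers.QuantumAdvantage.NaturalProofs: outside — W and T are AC⁰[⊕] lower bounds, a
class without pseudorandom function candidates where natural (Razborov–Smolensky) lower bounds are
PROVED; NaturalProofsScope records exactly this scope caveat.
- Literature.Barriers.QuantumAdvantage.NonclassicalDegreeLogBarrier: outside for W (a worst-case
SEARCH lower bound via planting, no correlation bound with low-degree polynomials is claimed); it
would bite an average-case / correlation form of L or T, which is not filed.
- Literature.Barriers.QuantumAdvantage.Relativization: not applicable — concrete circuit class vs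
explicit promise problem, no oracle; Algebrization likewise.
- Literature.Barriers.QuantumAdvantage.PPolyOracles: not applicable — no oracle (P/poly or other)
separation is claimed; W and T are fixed lower bounds for AC⁰[⊕] against ONE explicit promise
problem two classes below BPP (Aaronson–Chen 2017 Thms 7.6/8.1 constrain
efficiently-computable-oracle separations only).
- Literature.Barriers.QuantumAdvantage.SeparationPrerequisites: INSIDE for the route as a whole
(closes concludes the root `QuantumAdvantage`, so the P ≠ PP floor applies) — discharged exactly as
on AnfPresentation / TrustDial: the floor is carried by the declared residual LiftA (27984, the A03
gap promiseLift(AC0Mod 2 ∩ P) ⊄ PromiseBPP′) and by NearExactIsExact (14043); the attacked crux W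
(an AC⁰[⊕] search lower bou

History (route lifecycle, newest last):
- 2026-08-30T21:43:27Z · RESIDUAL declared: SearchLift (stmt-QuantumAdvantage-28208) — summit-strength until shown otherwise: writer g7 schema sync (D-0170): residual flag = the route's DECLARED RESIDUAL exactly as its critic-cleared node/docstri (planner-decomp-qadv-writer-1-g7-0)

sub-problem: QuantumAdvantage · status: draft · opened planner-decomp-qadv-writer-1-g6-0 2026-08-30T20:14:43Z · rev 0 · ledger route-QuantumAdvantage-FlatDial
GENERATED by the gate from the ledger (D-0016/17). Provers cite these decls: `theorem foo : Summit.QuantumAdvantage.QuantumAdvantage.Theses.FlatDial.<Decl> := …` in Summits/QuantumAdvantage/QuantumAdvantage/Theorems/<Name>.lean.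
-/

namespace Summit.QuantumAdvantage.QuantumAdvantage.Theses.FlatDial

open scoped BigOperators Topology Manifold Classical MeasureTheory ProbabilityTheory Matrix InnerProductSpace ComplexConjugate ContinuousMap
open Filter Set Function TopologicalSpace MeasureTheory

attribute [summit_statement] _root_.QuantumAdvantage

open Literature.QuantumAdvantage

/-- item stmt-QuantumAdvantage-27991 · target · rank 0 · open · by planner
why it might fail: an AC⁰[⊕] sign algorithm for exact cubic pairs — e.g. a constant-depth parity circuit extracting a normality flat (or the M-subspace) of G from its ANF and reading the sign off it; the quadratic analogue IS easy (ArfPin, g3).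
sources: arXiv:1411.5729, arXiv:2102.06963, doi:10.1145/28395.28404, doi:10.1017/cbo9780511976667
[support] aside — the NON-UNIFORM AC⁰[⊕] rung (STRONGER than RungA, `rungA_of_rungANonuniform`;
correctly not a binder): the ANF slice is not in promiseLift(AC0Mod 2). [difficulty: L] SIGN RECORD
(2026-08-30; lens-3 g7 «SignDial» node de39a6b3, 1297 l, farm rc0 · 0 sorry · 0 warn · axioms std ·
bc7 6/6 CLEAN; critic row 56 VERIFIED MEDIUM; NO items — AnfPresentation at cap): ONE certified
EQUIV RungANonuniform (27991 ⊒ 27983) ⟺ SignRungNU := «the slice IS the SIGN PROBLEM of a bent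
cubic: ε(F) = F̃(0) = [Σ(−1)^F < 0] given F and its NORMALISED dual» (kernel both ways: ⟸
sub-promise; ⟹ one-bit surgery `flip_realise` inside AC⁰[⊕], depth +2, size 2(s+N+1)+1); split
beneath SignRungNU ⟺ SignDepthTwo ∧ DepthClimbNU (`rungANonuniform_iff_split`): S = SignDepthTwo [W
· NECESSARY · WEAKER · OPEN · ATTACKABLE: covering law `rect_le` (Lindsey) + `sepVariety_le` PROVED
⇒ on paper every ∨- /∧-topped depth-2 AC⁰[⊕] circuit deciding BentSign on ONE translation orbit has ≥
2^(n/2−1) gates; the third form ⊕∘∧ SOLVES translation orbits in poly size (`eps_eq`) ⇒ the fight is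
on HIDDEN FRAMES F∘A where the answer reads B = A^{−T} (`dualBit_affine`); INSTRUMENTABLE T-SIGN-1
(sparse-separator / literal -/
@[route_item "route-QuantumAdvantage-FlatDial"]
def RungANonuniform : Prop :=
  Literature.Computability.QuantumComplexity.SignedExactCubicSliceANF ∉ Literature.Computability.Complexity.promiseLift (Literature.Computability.Complexity.AC0Mod 2)

/-- item stmt-QuantumAdvantage-28207 · crux · rank 2 · open · by planner
why it might fail: a parallel second-derivative flat finder: for cubic G the second derivatives D_aD_bG are affine, so a constant-depth ⊕-circuit might assemble a normality flat (e.g. of near-canonical/mixed product type, K-FLAT8) from the table of all D_aD_bG without ever inverting a frame.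
sources: arXiv:2304.13432, doi:10.1145/28395.28404, doi:10.1017/9781108606806, arXiv:1411.5729
[crux] W — FLAT SEARCH IS AC⁰[⊕]-HARD (node def `FlatSearchHard`, tree vocabulary
`Theorems.FlatDial.realisableOutG` / `finders`, junction `Iff.rfl` = the hypothesis type of the
LANDED `no_finder_of_recovery` / `signedSlice_not_mem_promiseLift_of_split`): there is NO family c
of certificate maps, one per arity n, computed output-bit-wise by AND/OR/NOT/⊕ circuits of constant
depth and polynomial size reading the ANF table of the cubic form G ALONE, such that for every even
n and every G that is a signed cubic dual (G ⊕ b = F̃ for some cubic bent F) AND weakly normal, c(G)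
is a VALID FLAT CERTIFICATE (a point a and n/2 affinely independent directions spanning E with G
constant on a + E). TAGS (critic rows 71 VERIFIED / 71v2 CLEARED): NECESSARY for T modulo N alone
(`no_finder_of_signedSlice_not_mem hN hT`, tree module 4; for T′ unconditionally) · WEAKER by
evidence (search ⊋ decision: a checkable (n²/2+2n)-bit witness vs one bit, converse = L unknown
inside AC⁰[⊕]; QUADRATIC CALIBRATION: the quadratic decision problem T′₂ is AC⁰[⊕]∩P-EASY (ArfPin)
while quadratic flat search W₂ ⊇ Lagrangian-subspace / 𝔽₂-basis extraction has no AC⁰[⊕] algorithm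
and AC⁰[⊕]-hard decision shadows (rank, -/
@[route_item "route-QuantumAdvantage-FlatDial", crux (bottleneck := work) (source := "ledger D-0171 leaf tag ATTACKABLE on stmt-QuantumAdvantage-28207, 2026-09-01")]
def FlatSearchHard : Prop :=
  ¬ ∃ c : (n : ℕ) → (Fin (Summit.QuantumAdvantage.QuantumAdvantage.Theorems.FlatDial.formN n) → Bool) → Summit.QuantumAdvantage.QuantumAdvantage.Theorems.FlatDial.CertIdx n → Bool, c ∈ Summit.QuantumAdvantage.QuantumAdvantage.Theorems.FlatDial.realisableOutG Summit.QuantumAdvantage.QuantumAdvantage.Theorems.FlatDial.CertIdx ∧ c ∈ Summit.QuantumAdvantage.QuantumAdvantage.Theorems.FlatDial.finders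

/-- item stmt-QuantumAdvantage-28208 · crux · RESIDUAL (gen 0; summit-strength until shown otherwise, D-0170) · rank 3 · open · by planner
why it might fail: exactly if flat SEARCH is AC⁰[⊕]-hard for generic reasons (witness non-uniqueness, basis extraction) while the one-bit SIGN has a degree-3-specific constant-depth ⊕-formula avoiding certificates — the quadratic face behaves precisely so (search hard-looking, decision easy).
sources: arXiv:1411.5729, arXiv:2102.06963, doi:10.1145/28395.28404, arXiv:2304.13432
[crux] L — DECLARED RESIDUAL of the split (NEW; filed in the decl-name form «FlatSearchHard →
RungANonuniform», the RigidityDial.RigidLiftOdd / TrustDial.PolarLift pattern; ≡ T modulo W,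
`searchLift_of_target` trivially; the node's own form NodeSearchLift := W → T′ IMPLIES the filed
form unconditionally by the LANDED `signedSlice_not_mem_promiseLift_of_split`
(`searchLift_of_node`), and the filed form gives the node form back modulo N (`node_of_searchLift`)
— so the side condition N is folded into L and is never a `closes` hypothesis, critic 71v2):
SEARCH-TO-DECISION INSIDE AC⁰[⊕] FOR NORMALITY FLATS — if no AC⁰[⊕] family finds a flat of a
weakly-normal signed cubic dual from its table, then no AC⁰[⊕] family decides the sign of exact
cubic ANF pairs. It carries the part of 27991 NOT explained by certificate search: a decision
circuit need not output a flat, and flats are far from unique (K-FLAT8), so the classical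
witness-extraction-by-self-reduction is unavailable at constant depth. TAGS: DECLARED RESIDUAL ·
UNDECIDED · IDEA-NEEDED (no technique converts an AC⁰[⊕] DECISION circuit for the sign into an
AC⁰[⊕] flat FINDER; must use degree 3 by the quadratic calibration) · no catalog -/
@[route_item "route-QuantumAdvantage-FlatDial", crux (bottleneck := idea) (source := "ledger wanted_by.residual on stmt-QuantumAdvantage-28208, 2026-09-01")]
def SearchLift : Prop :=
  FlatSearchHard → RungANonuniform

/-- item stmt-QuantumAdvantage-14043 · crux · rank 5 · open · by planner
why it might fail: a sequence of cubic pairs with Φ → 1 from below without ever being exact (bent g with NON-cubic dual close to RM(3): Φ = 1 − 2·dist(g̃, RM(3,n))/2ⁿ; known caps 3/4, 7/8 leave room above).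
sources: arXiv:1411.5729, doi:10.1017/cbo9780511976667
[crux] ISOLATION OF EXACTNESS (rank 2; replaces the refuted CubicStability, route-choice
2026-08-16): there is an absolute θ < 1 such that for every even n and all Boolean f, g of 𝔽₂-degree
≤ 3, Φ(f,g) > θ ⇒ Φ(f,g) = 1 (g bent with dual exactly f; DuttaMaitraMukherjee2024 §3). Conjectured
sharp constant θ = 7/8, ATTAINED: T-family (refuter 494f1478 on stmt-2202) b = y′·T(y″), T =
(y₁,y₂,y₃,y₄+y₁y₂,y₅+y₃y₄), a = cubic truncation of the quartic dual, n = 10, Φ = 7/8. What it does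
for the line: above θ the signed cubic 2-fold problem IS the signed exact slice (r3 = X at threshold
θ; CruxAtThreshold / crux_of_threshold in Cruxes/SignedCubicForrelationInPrBPP/Disproof.lean §2), so
the exact slice is representative of everything near ±1; the band [3/5, θ] — where the refutation
witnesses live (P₄ n=12 Φ=625/1024; n=8 pair Φ=39/64; P₂ 25/32; T^{⊗3} 0.670; P₂⊗T 0.684), all
decomposable with blockwise-trivial |Φ| and sign — is left to r7's anchor/block programme, not to
localisation. Known mechanisms and caps: one-sided Kasami–Tokura perturbation Φ = 1 − 2·wt ≤ 3/4;
bent g with NON-cubic dual: Φ = 1 − 2·dist(g̃, RM(3,n))/2ⁿ ≤ 7/8 when deg g̃ = 4 (d_min RM(4,n) =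
2ⁿ/16), while Hou's bound de -/
@[route_item "route-QuantumAdvantage-FlatDial", crux]
def NearExactIsExact : Prop :=
  ∃ θ : ℝ, θ < 1 ∧ ∀ n : ℕ, Even n → ∀ f g : (Fin n → Bool) → Bool, Literature.Computability.QuantumComplexity.IsDegLeFun 3 f → Literature.Computability.QuantumComplexity.IsDegLeFun 3 g → θ < Literature.Computability.QuantumComplexity.forrelation f g → Literature.Computability.QuantumComplexity.forrelation f g = 1

/-- item stmt-QuantumAdvantage-27982 · support · rank 9 · open · by planner
sources: arXiv:1411.5729, arXiv:2102.06963
[target] X = r3_ANF (rank-0 record of the refined residual): the signed exact cubic Forrelation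
slice in ANF presentation — the landed Literature promise problem `SignedExactCubicSliceANF`
(defn-SignedExactCubicSliceANF: instances (n, F, G), F, G : CubicForm n = constant bit + n³
coefficient table, value forrelation F.eval G.eval, yes Φ = 1 / no Φ = −1, n even) — is not in
PromiseBPP'. EQUIVALENT to CubicForrelation's r3 (stmt-13932) by the PROVED E_pres (support
AnfEquiv); hence exactly as open and as A03-exposed as r3 (residual grade) — its role is to carry
the class ladder RungAC0 / RungP / RungA / … which is contentful only at this grain. [deps: RungA,
LiftA, AnfEquiv] [difficulty: open-problem] -/
@[route_item "route-QuantumAdvantage-FlatDial"]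
def AnfResidual : Prop :=
  Literature.Computability.QuantumComplexity.SignedExactCubicSliceANF ∉ Literature.Computability.Complexity.PromiseBPP'

/-- item stmt-QuantumAdvantage-27983 · support · rank 9 · open · by planner
sources: arXiv:1411.5729, doi:10.1145/28395.28404
[crux] P1, the AC⁰[⊕] ∩ P RUNG of the ANF ladder: the ANF slice is not in promiseLift(AC0Mod 2 ∩ P)
— no polynomial-time language decided by constant-depth polynomial-size circuits with parity gates
separates the Φ = +1 table-pairs from the Φ = −1 table-pairs; equivalently the affine invariant s(F)
of cubic bent functions with cubic duals is not an AC⁰[⊕] ∩ P function of the pair of tables.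
NECESSARY (node `rungA_of_anfResidual`: PromiseP ⊆ PromiseBPP', promiseLift_mono) · strictly WEAKER
(sub-BPP class) · FLOOR-FREE (a class statement at a grain where the W-slice law does not bite) ·
CONTENTFUL · UNDECIDED with STATED TESTS: T-ANF-1 (Q_Arf⁺) is Arf(Q) of a nondegenerate quadratic
form over 𝔽₂ computable in AC⁰[⊕] from (B_Q, B_Q⁻¹, diag)? — decides the quadratic grade QuadRungA
outright; T-ANF-2 (un-mixing) hidden MM cubic pairs (x′·π(x″) ⊕ h(x″)) ∘ A: in identity coordinates
the sign h(π⁻¹(0)) is AC⁰[⊕]-EASY (degenerate-witness pass), so hardness must come from un-mixing A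
(rank/solve over 𝔽₂, ⊕L-complete) or from non-MM pairs; T-ANF-3 census of s(F) over all cubic bent F
with cubic dual at n = 6, 8 against small depth-2 AC⁰[⊕] formulas. ATTACKABLE both ways (prove:
MAJ/MOD₃ ≤_pro -/
@[route_item "route-QuantumAdvantage-FlatDial"]
def RungA : Prop :=
  Literature.Computability.QuantumComplexity.SignedExactCubicSliceANF ∉ Literature.Computability.Complexity.promiseLift (Literature.Computability.Complexity.AC0Mod 2 ∩ Literature.Computability.Complexity.Classes.P)

/-- item stmt-QuantumAdvantage-27984 · crux · rank 4 · open · by planner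
why it might fail: it is X-hard given RungA: a prBPP (even P) sign algorithm using un-mixing by Gaussian elimination (outside AC⁰[⊕]) — e.g. a poly-time M-subspace finder, the parent line's open stub — would make RungA true and LiftA false.
sources: arXiv:1411.5729, doi:10.1017/cbo9780511976667, arXiv:2102.06963
[crux] P2, the DECLARED RESIDUAL · NO-SHRINK (≡ X once RungA holds; `liftA_iff`; necessary
vacuously, `liftA_of_anfResidual`): from «the ANF slice ∉ promiseLift(AC⁰[⊕] ∩ P)» to «the ANF slice
∉ PromiseBPP'» — the BPP-vs-AC⁰[⊕] gap of the sign problem of exact cubic pairs, i.e. the summit's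
own difficulty at this node, undivided. COSTUME-class by its consequent (A03
SeparationPrerequisites: an unconditional prBQP ⊄ prBPP′-strength statement), declared as such;
BARRIER-tagged in the text (natural proofs bite every rung 𝒞 ⊇ TC⁰ on the way up). Filed so the
route is honest about what separates RungA from X; not expected to shrink. [deps: RungA]
[difficulty: open-problem] -/
@[route_item "route-QuantumAdvantage-FlatDial", crux (bottleneck := idea) (source := "ledger D-0171 leaf tag IDEA-NEEDED on stmt-QuantumAdvantage-27984, 2026-09-01")]
def LiftA : Prop :=
  RungA → Literature.Computability.QuantumComplexity.SignedExactCubicSliceANF ∉ Literature.Computability.Complexity.PromiseBPP'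

/-- item stmt-QuantumAdvantage-27985 · support · rank 9 · open · by planner
sources: arXiv:1411.5729
[support] K2 of route CubicForrelation (stmt-QuantumAdvantage-14830, body VERBATIM — shared item,
PROVED: `Theorems.SignedExactSliceIsLift.signedExactSliceIsLift_holds`): NearExactIsExact ⟹ the
signed exact cubic slice (circuit presentation) ∈ promiseLift BQP (Hadamard-test family on
interpolated cubic ANFs, AND-amplified). [deps: NearExactIsExact] [difficulty: S] -/
@[route_item "route-QuantumAdvantage-FlatDial", crux]
def SignedExactSliceIsLift : Prop :=
  NearExactIsExact → (⟨Literature.Computability.QuantumComplexity.KForrelationInstance.encode '' {I | I.IsOverB2 ∧ I.value = 1 ∧ I.k = 2 ∧ Even I.n ∧ ∀ i, Literature.Computability.QuantumComplexity.IsDegLeFun 3 (I.C i).eval}, Literature.Computability.QuantumComplexity.KForrelationInstance.encode '' {I | I.IsOverB2 ∧ I.value = -1 ∧ I.k = 2 ∧ Even I.n ∧ ∀ i, Literature.Computability.QuantumComplexity.IsDegLeFun 3 (I.C i).eval}⟩ : Literature.Computability.Complexity.PromiseProblem) ∈ Literature.Computability.Complexity.promiseLift Literature.Computability.Cryptogr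aphy.BQP

/-- item stmt-QuantumAdvantage-27986 · support · rank 9 · open · by planner
sources: arXiv:1411.5729, doi:10.1017/cbo9780511976667
[support] E_pres, THE ONE EQUIV OF THE LENS, PROVED BOTH WAYS in the node
(`parentResidual_iff_anfResidual`, hypothesis-free, axioms standard): CubicForrelation's r3
(stmt-13932, body verbatim on the left) ↔ AnfResidual. Directions = genuine Karp reductions between
code-promises: ANF ≤ₚ circuits (parse the table code, list the monomials, emit K2's canonical
XOR-of-ANDs netlists — certificate `K2.stub_anfEmitFP`; value, degree, well-formedness preserved)
and circuits ≤ₚ ANF (degree-3 truncated MÖBIUS coefficients of both circuit oracles at the clamped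
arity — certificate `K2.stub_coeffFP`; exactness on cubic oracles = K2's RM(3) algebra
`stub_moebius`), composed with the landed
`PromiseProblem.mem_PromiseBPP'_of_polyTimeReducible_holds'`. Load-bearing binder of closes.
LANDING: the node VENDORS ≈ 690 lines of the accepted K2 certificate modules
(`…SignedExactSliceIsLift{StubAnfEmitFP, StubAnfCircuitAux, main part 2, StubCoeffFP}`) because
their hub oleans are unbuilt since the 2026-08-24 world build (critic chk/IMP.lean: bare imports
rc75, OPS FLAG 04:06:07Z); the Theorems proposal must import the tree modules once rebuilt —
«PROVED, landing blocked on farm rebuild, not on mathemati -/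
@[route_item "route-QuantumAdvantage-FlatDial", crux]
def AnfEquiv : Prop :=
  ((⟨Literature.Computability.QuantumComplexity.KForrelationInstance.encode '' {I | I.IsOverB2 ∧ I.value = 1 ∧ I.k = 2 ∧ Even I.n ∧ ∀ i, Literature.Computability.QuantumComplexity.IsDegLeFun 3 (I.C i).eval}, Literature.Computability.QuantumComplexity.KForrelationInstance.encode '' {I | I.IsOverB2 ∧ I.value = -1 ∧ I.k = 2 ∧ Even I.n ∧ ∀ i, Literature.Computability.QuantumComplexity.IsDegLeFun 3 (I.C i).eval}⟩ : Literature.Computability.Complexity.PromiseProblem) ∉ Literature.Computability.Complexity.PromiseBPP') ↔ AnfResidual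

/-- item stmt-QuantumAdvantage-28209 · assembly · rank 1 · closed · proved by Summit.QuantumAdvantage.QuantumAdvantage.Theorems.flatDial_assembly (prover) · by planner
sources: arXiv:1411.5729, doi:10.1145/28395.28404
[assembly] NearExactIsExact → SignedExactSliceIsLift → FlatSearchHard → SearchLift → LiftA →
AnfEquiv → QuantumAdvantage (kernel `assembly_holds`). -/
@[route_item "route-QuantumAdvantage-FlatDial"]
def Assembly : Prop :=
  NearExactIsExact → SignedExactSliceIsLift → FlatSearchHard → SearchLift → LiftA → AnfEquiv → QuantumAdvantage

-- `Assembly` holds: proved by `Summit.QuantumAdvantage.QuantumAdvantage.Theorems.flatDial_assembly` (its module imports this route file, so no `_holds` link can be stated here).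

/-! D-0027 §2.1 — DECIDING THEOREM (planner-authored via `route open/edit --closes-file`; by planner-decomp-qadv-writer-1-g6-0 2026-08-30T20:14:43Z):
its hypotheses are this route's items and its conclusion the sub-problem Statement (glue_lint), and it elaborates with this file. -/

/-- Deciding theorem of route FlatDial (writer g6, 2026-08-30; lens-3 g11 node «FlatDial» rev 3 cbbf0309, critic rows 71/71v2–71v5;
tree modules Theorems.FlatDialReadout/Circuit/Search/Strings LANDED): the inherited AnfPresentation chain with its blocker RungA (27983)
obtained from T = RungANonuniform (27991) — itself the modus ponens of the flat-search split W `FlatSearchHard` (attacked crux) and the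
declared residual L `SearchLift := FlatSearchHard → RungANonuniform` — by promiseLift monotonicity (AC0Mod 2 ∩ P ⊆ AC0Mod 2); then
LiftA (27984, the parent's A03 residual) puts the ANF slice outside PromiseBPP', E_pres (27986) transports to the circuit presentation r3,
and K2 (27985) under NearExactIsExact (14043) puts the slice in promiseLift BQP, so BQP ⊆ BPP (¬ QuantumAdvantage) is contradictory
(`promiseLift_mono`, `PromiseBPP_subset_PromiseBPP'_holds`). Binders consumed 6/6; RungANonuniform, RungA, AnfResidual are in the cone
as the types inside SearchLift / LiftA / AnfEquiv. 0 sorry; axioms propext / Classical.choice / Quot.sound (Sketch.lean). -/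
@[closes "route-QuantumAdvantage-FlatDial"] theorem closes (h₁ : NearExactIsExact) (h₂ : SignedExactSliceIsLift) (w : FlatSearchHard) (ℓ : SearchLift) (p₂ : LiftA)
    (hE : AnfEquiv) : QuantumAdvantage := by
  have p₁ : RungA := fun hA => (ℓ w) (Literature.Computability.Complexity.promiseLift_mono Set.inter_subset_left hA)
  have h₃ := hE.mpr (p₂ p₁)
  by_contra hQA
  refine h₃ (Literature.Computability.Complexity.PromiseBPP_subset_PromiseBPP'_holds
    (Literature.Computability.Complexity.promiseLift_mono (fun L hL => ?_) (h₂ h₁)))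
  by_contra hLn
  exact hQA ⟨L, hL, hLn⟩

end Summit.QuantumAdvantage.QuantumAdvantage.Theses.FlatDial
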